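import Literature.FieldTheory.FunctionField.RationalWildRamification
import HarnessLib

/-!
# The divisor of a pulled-back differential on `P¹`: `v_a(σ_w^*ω) = e_a · v_{w(a)}(ω) + (e_a − 1)` at every place
# (tame; `≥` in general) — poles of `σ_w^*ω` lie over poles of `ω`, first kind pulls back to first kind, simple poles
# to simple poles (Stichtenoth, Def. 3.1.5, Thm. 3.4.6/(3.41) with Thm. 3.5.1, Ch. 4 Exercise 4.8 (1))

Topic `Literature/FieldTheory/FunctionField`; namespace `Literature.FieldTheory.FunctionField`.  Lane `lit-hodgefound`
(Track 2 foundations library), seat p01 gen 22, row g22-#11.  THEOREMS ONLY (no definition, no named fact, no instance,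
no notation; D-0014/D-0026, net Literature debt 0).  Sequel BY IMPORT of g22-#9/g22-#7 (`order_laurentSubst`,
`order_derivative_of_cast_order_ne_zero`, `order_sub_one_le_order_derivative`, `le_order_laurentSubst_mul_derivative`),
g22-#5/g22-#3 (the expansions of `f ∘ w` at all places: `ratFuncExpansionAt_ratFuncSubst` and its `∞`-variants) and
gen 21 (`ratFuncExpansionAt_derivation`, `ratFuncExpansionAtInfty_derivation`) — REUSED, nothing restated.  Where g22-#6
computed the RESIDUE of `σ_w^*ω` and g22-#7/g22-#9 the order of `dw`, this file computes the ORDER of `σ_w^*ω` for an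
arbitrary `ω = f dt`.

## Sources, VERBATIM

H. Stichtenoth [Stichtenoth2009]: Def. 3.1.5 (PDF p0068) «`v_{P′}(x) = e · v_P(x)` for all `x ∈ F`»; Thm. 3.4.13 proof,
(3.41) (PDF p0092) «`(Cotr_{F′/F}(ω)) = Con_{F′/F}((ω)) + Diff(F′/F)`» with Thm. 3.5.1 (b) «`d(P′|P) = e(P′|P) − 1` if
and only if `e(P′|P)` is not divisible by `char K`» and (a) «`d(P′|P) ≥ e(P′|P) − 1`» — i.e. at a place `P′|P`,
`v_{P′}(Cotr ω) = e · v_P(ω) + d(P′|P)`; Ch. 4 Exercise 4.8 (1) (PDF p0156) «`ω` is called regular (or a differential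
of the first kind), if `ω = 0` or `(ω) ≥ 0`»; Prop. 1.2.1 (c) (the place `∞`, prime element `1/x`).

## What is proved (`K` any field, `w ∈ K(t)` non-constant, `σ_w f = f ∘ w`, tree `(D, hD)` convention, `f ≠ 0`)

* finite `a ↦ b = w(a)`, `u = E_a(w) − b` of order `e`: **`order_ratFuncExpansionAt_pullback`** (tame, `e ≠ 0` in `K`:
  `v_a((f∘w)·Dw) = v_b(f)·e + (e − 1)`), **`le_order_ratFuncExpansionAt_pullback`** (any `e`, `w` separable:
  `v_b(f)·e + (e − 1) ≤ v_a((f∘w)·Dw)`), hence `order_ratFuncExpansionAt_pullback_nonneg` (regular at `b` ⟹ regular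
  at `a`: first kind pulls back to first kind, poles of `σ_w^*ω` lie over poles of `ω`) and
  `order_ratFuncExpansionAt_pullback_of_simple_pole` (tame: a simple pole at `b` pulls back to a SIMPLE pole at `a`,
  whatever `e` — third kind to third kind, cf. the residues `e · Res` of g22-#6);
* `a ↦ ∞` (pole of `w` of order `e`, tame): **`order_ratFuncExpansionAt_pullback_of_pole`**
  (`v_a((f∘w)·Dw) = (v_∞(f) − 2)·e + (e − 1)`, `v_∞(f) − 2` being the order of `f dt` at `∞`, `dt = −s^{−2} ds`);
* `∞ ↦ b` and `∞ ↦ ∞` (tame): **`order_ratFuncExpansionAtInfty_pullback_of_finite`**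
  (`v(E_∞((f∘w)·Dw)) = v_b(f)·e + (e + 1)`, i.e. order of the form at `∞` `= v_b(f)·e + (e − 1)`) and
  **`order_ratFuncExpansionAtInfty_pullback_of_pole`** (`= (v_∞(f) − 2)·e + (e + 1)`).

## Honest scope

`K`-rational places; equalities under the tame hypothesis, the general case as an inequality at finite places only; no
divisor objects (orders place by place).
-/

noncomputable section

open Polynomial HahnSeries LaurentSeries PowerSeries

namespace Literature.FieldTheory.FunctionField

variable {K : Type*} [Field K]

/-- `v(x⁻¹) = −v(x)`. [folklore] -/
private theorem order_inv'' (x : K⸨X⸩) : x⁻¹.order = -x.order := by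
  by_cases hx : x = 0
  · rw [hx, inv_zero, HahnSeries.order_zero, neg_zero]
  · have h := HahnSeries.order_mul hx (inv_ne_zero hx)
    rw [mul_inv_cancel₀ hx, HahnSeries.order_one] at h
    omega

/-- `v((u⁻¹)′) = v(u′) − 2 v(u)` (`(u⁻¹)′ = −u⁻² u′`). [folklore] -/
private theorem order_derivative_inv {u : K⸨X⸩} (hu0 : u ≠ 0) (hne : LaurentSeries.derivative K u ≠ 0) :
    LaurentSeries.derivative K u⁻¹ ≠ 0 ∧
      (LaurentSeries.derivative K u⁻¹).order = (LaurentSeries.derivative K u).order - 2 * u.order := by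
  have hder : LaurentSeries.derivative K u⁻¹ = -(u ^ (2 : ℕ))⁻¹ * LaurentSeries.derivative K u := by
    rw [← zpow_neg_one, Literature.RingTheory.PowerSeries.laurent_derivative_zpow, neg_smul, one_smul,
      show (-1 : ℤ) - 1 = -(2 : ℕ) by norm_num, zpow_neg, zpow_natCast, neg_mul]
  have hu2 : -(u ^ (2 : ℕ))⁻¹ ≠ 0 := neg_ne_zero.mpr (inv_ne_zero (pow_ne_zero 2 hu0))
  refine ⟨by rw [hder]; exact mul_ne_zero hu2 hne, ?_⟩
  rw [hder, HahnSeries.order_mul hu2 hne, HahnSeries.order_neg, order_inv'', pow_two, HahnSeries.order_mul hu0 hu0]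
  ring

/-- `v((−sⁿ)·x) = v(x) + n` for `x ≠ 0` (`E_∞(Dg) = (−s²)·∂_s E_∞ g`). [folklore] -/
private theorem order_neg_single_mul {x : K⸨X⸩} (hx : x ≠ 0) (n : ℤ) :
    -(single n (1 : K) : K⸨X⸩) * x ≠ 0 ∧ (-(single n (1 : K) : K⸨X⸩) * x).order = x.order + n := by
  have hs : -(single n (1 : K) : K⸨X⸩) ≠ 0 := by
    rw [Ne, neg_eq_zero, HahnSeries.single_eq_zero_iff]
    exact one_ne_zero
  refine ⟨mul_ne_zero hs hx, ?_⟩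
  rw [HahnSeries.order_mul hs hx, HahnSeries.order_neg, HahnSeries.order_single one_ne_zero, add_comm]

section Subst

variable (w : RatFunc K) (hw : ¬ ∃ c, w = RatFunc.C c)
include hw

/-- The uniformizers attached to a non-constant `w` are non-zero. [folklore] -/
private theorem expansion_ne_zero'' (a b : K) :
    ratFuncExpansionAt a w - HahnSeries.C b ≠ 0 ∧ ratFuncExpansionAt a w⁻¹ ≠ 0 ∧
      ratFuncExpansionAtInfty w⁻¹ ≠ 0 ∧ ratFuncExpansionAtInfty w - HahnSeries.C b ≠ 0 := by
  have hw0 : w ≠ 0 := fun h => hw ⟨0, by rw [h, map_zero]⟩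
  have hwb : w - RatFunc.C b ≠ 0 := sub_ne_zero.mpr fun h => hw ⟨b, h⟩
  refine ⟨?_, (_root_.map_ne_zero _).mpr (inv_ne_zero hw0), (_root_.map_ne_zero _).mpr (inv_ne_zero hw0), ?_⟩
  · rw [← ratFuncExpansionAt_C a b, ← map_sub]
    exact (_root_.map_ne_zero _).mpr hwb
  · rw [← ratFuncExpansionAtInfty_C b, ← map_sub]
    exact (_root_.map_ne_zero _).mpr hwb

variable (D : Derivation K (RatFunc K) (RatFunc K))
  (hD : ∀ P : K[X], D (algebraMap K[X] (RatFunc K) P) = algebraMap K[X] (RatFunc K) (derivative P))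
include hD

/-! ### Finite `a ↦ b = w(a)` -/

/-- **The order of a pulled-back differential at a tame point** (Def. 3.1.5 + Dedekind (b): `v_{P′}(Cotr ω) =
e·v_P(ω) + (e − 1)`): if `u := E_a(w) − b` has positive order `e` with `e ≠ 0` in `K`, then for `f ≠ 0`
`v_a((f ∘ w) · Dw) = v_b(f) · e + (e − 1)`. [cite: Stichtenoth2009, Def. 3.1.5, Thm. 3.5.1 (b), Thm. 3.4.13 (3.41)] -/
theorem order_ratFuncExpansionAt_pullback {a b : K} (hu : 0 < (ratFuncExpansionAt a w - HahnSeries.C b).orderTop)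
    (he : ((ratFuncExpansionAt a w - HahnSeries.C b).order : K) ≠ 0) {f : RatFunc K} (hf : f ≠ 0) :
    (ratFuncExpansionAt a (ratFuncSubst w hw f * D w)).order =
      (ratFuncExpansionAt b f).order * (ratFuncExpansionAt a w - HahnSeries.C b).order +
        ((ratFuncExpansionAt a w - HahnSeries.C b).order - 1) := by
  have hu0 := (expansion_ne_zero'' w hw a b).1
  have hder : LaurentSeries.derivative K (ratFuncExpansionAt a w) =
      LaurentSeries.derivative K (ratFuncExpansionAt a w - HahnSeries.C b) := by
    rw [map_sub, Literature.RingTheory.PowerSeries.derivative_C, sub_zero]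
  rw [map_mul, ratFuncExpansionAt_ratFuncSubst w hw hu f, ratFuncExpansionAt_derivation D hD a w, hder,
    Literature.RingTheory.PowerSeries.order_laurentSubst_mul_derivative hu hu0 he ((_root_.map_ne_zero _).mpr hf)]

/-- **Any characteristic (Dedekind (a))**: for `w` separable (`Dw ≠ 0`) and `f ≠ 0`,
`v_b(f) · e + (e − 1) ≤ v_a((f ∘ w) · Dw)`. [cite: Stichtenoth2009, Def. 3.1.5, Thm. 3.5.1 (a)] -/
theorem le_order_ratFuncExpansionAt_pullback {a b : K} (hu : 0 < (ratFuncExpansionAt a w - HahnSeries.C b).orderTop)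
    (hsep : D w ≠ 0) {f : RatFunc K} (hf : f ≠ 0) :
    (ratFuncExpansionAt b f).order * (ratFuncExpansionAt a w - HahnSeries.C b).order +
        ((ratFuncExpansionAt a w - HahnSeries.C b).order - 1) ≤
      (ratFuncExpansionAt a (ratFuncSubst w hw f * D w)).order := by
  have hu0 := (expansion_ne_zero'' w hw a b).1
  have hder : LaurentSeries.derivative K (ratFuncExpansionAt a w) =
      LaurentSeries.derivative K (ratFuncExpansionAt a w - HahnSeries.C b) := by
    rw [map_sub, Literature.RingTheory.PowerSeries.derivative_C, sub_zero]
  have hne : LaurentSeries.derivative K (ratFuncExpansionAt a w - HahnSeries.C b) ≠ 0 := by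
    rw [← hder, ← ratFuncExpansionAt_derivation D hD a w]
    exact (_root_.map_ne_zero _).mpr hsep
  rw [map_mul, ratFuncExpansionAt_ratFuncSubst w hw hu f, ratFuncExpansionAt_derivation D hD a w, hder]
  exact Literature.RingTheory.PowerSeries.le_order_laurentSubst_mul_derivative hu hu0 hne
    ((_root_.map_ne_zero _).mpr hf)

/-- **First kind pulls back to first kind / poles of `σ_w^*ω` lie over poles of `ω`**: if `f` is regular at `b = w(a)`
(`v_b(f) ≥ 0`) then `(f ∘ w) · Dw` is regular at `a` — any characteristic, `w` separable.
[cite: Stichtenoth2009, Ch. 4 Exercise 4.8 (1), Thm. 3.5.1 (a)] -/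
theorem order_ratFuncExpansionAt_pullback_nonneg {a b : K} (hu : 0 < (ratFuncExpansionAt a w - HahnSeries.C b).orderTop)
    (hsep : D w ≠ 0) {f : RatFunc K} (hf : f ≠ 0) (hreg : 0 ≤ (ratFuncExpansionAt b f).order) :
    0 ≤ (ratFuncExpansionAt a (ratFuncSubst w hw f * D w)).order := by
  have hu0 := (expansion_ne_zero'' w hw a b).1
  have he : 1 ≤ (ratFuncExpansionAt a w - HahnSeries.C b).order := by
    have h := hu
    rw [← order_eq_orderTop_of_ne_zero hu0] at h
    have := WithTop.coe_pos.mp h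
    omega
  have h := le_order_ratFuncExpansionAt_pullback w hw D hD hu hsep hf
  nlinarith

/-- **Simple poles pull back to simple poles (tame)**: if `f` has a simple pole at `b = w(a)` and `e_a ≠ 0` in `K` then
`(f ∘ w) · Dw` has a simple pole at `a` — whatever `e_a` is (`(−1)·e + (e − 1) = −1`; the residue is multiplied by
`e_a`, g22-#6). [cite: Stichtenoth2009, Def. 3.1.5, Thm. 3.5.1 (b)] -/
theorem order_ratFuncExpansionAt_pullback_of_simple_pole {a b : K}
    (hu : 0 < (ratFuncExpansionAt a w - HahnSeries.C b).orderTop)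
    (he : ((ratFuncExpansionAt a w - HahnSeries.C b).order : K) ≠ 0) {f : RatFunc K}
    (hf : (ratFuncExpansionAt b f).order = -1) :
    (ratFuncExpansionAt a (ratFuncSubst w hw f * D w)).order = -1 := by
  have hf0 : f ≠ 0 := fun h => by
    rw [h, map_zero, HahnSeries.order_zero] at hf
    exact absurd hf (by norm_num)
  rw [order_ratFuncExpansionAt_pullback w hw D hD hu he hf0, hf]
  ring

/-! ### The places involving `∞` (tame) -/

/-- **`a ↦ ∞`** (`u := E_a(1/w)` of positive order `e`, `e ≠ 0` in `K`): for `f ≠ 0`,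
`v_a((f ∘ w) · Dw) = (v_∞(f) − 2) · e + (e − 1)` — `v_∞(f) − 2` is the order at `∞` of the form `f dt = −s^{−2} f ds`.
[cite: Stichtenoth2009, Def. 3.1.5, Prop. 1.2.1 (c), Thm. 3.5.1 (b)] -/
theorem order_ratFuncExpansionAt_pullback_of_pole {a : K} (hu : 0 < (ratFuncExpansionAt a w⁻¹).orderTop)
    (he : ((ratFuncExpansionAt a w⁻¹).order : K) ≠ 0) {f : RatFunc K} (hf : f ≠ 0) :
    (ratFuncExpansionAt a (ratFuncSubst w hw f * D w)).order =
      ((ratFuncExpansionAtInfty f).order - 2) * (ratFuncExpansionAt a w⁻¹).order +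
        ((ratFuncExpansionAt a w⁻¹).order - 1) := by
  have hu0 := (expansion_ne_zero'' w hw a 0).2.1
  have hw' : ratFuncExpansionAt a w = (ratFuncExpansionAt a w⁻¹)⁻¹ := by rw [map_inv₀, inv_inv]
  have hdu := Literature.RingTheory.PowerSeries.derivative_ne_zero_of_cast_order_ne_zero hu0 he
  obtain ⟨hdne, hdord⟩ := order_derivative_inv hu0 hdu
  have hfne : ratFuncExpansionAtInfty f ≠ 0 := (_root_.map_ne_zero _).mpr hf
  rw [map_mul, ratFuncExpansionAt_ratFuncSubst_of_pole w hw hu f, ratFuncExpansionAt_derivation D hD a w, hw',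
    HahnSeries.order_mul (Literature.RingTheory.PowerSeries.laurentSubst_ne_zero _ hfne) hdne,
    Literature.RingTheory.PowerSeries.order_laurentSubst hu hu0 hfne, hdord,
    Literature.RingTheory.PowerSeries.order_derivative_of_cast_order_ne_zero hu0 he]
  ring

/-- **`∞ ↦ b` finite** (`u := E_∞(w) − b` of positive order `e`, tame): for `f ≠ 0`,
`v(E_∞((f ∘ w) · Dw)) = v_b(f) · e + (e + 1)` (`E_∞(Dw) = −s² ∂_s E_∞ w`; the order at `∞` of the FORM `(f∘w)·Dw dt`
is this minus `2`, i.e. `v_b(f)·e + (e − 1)`). [cite: Stichtenoth2009, Def. 3.1.5, Prop. 1.2.1 (c), Thm. 3.5.1 (b)] -/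
theorem order_ratFuncExpansionAtInfty_pullback_of_finite {b : K}
    (hu : 0 < (ratFuncExpansionAtInfty w - HahnSeries.C b).orderTop)
    (he : ((ratFuncExpansionAtInfty w - HahnSeries.C b).order : K) ≠ 0) {f : RatFunc K} (hf : f ≠ 0) :
    (ratFuncExpansionAtInfty (ratFuncSubst w hw f * D w)).order =
      (ratFuncExpansionAt b f).order * (ratFuncExpansionAtInfty w - HahnSeries.C b).order +
        ((ratFuncExpansionAtInfty w - HahnSeries.C b).order + 1) := by
  have hu0 := (expansion_ne_zero'' w hw b b).2.2.2
  have hder : LaurentSeries.derivative K (ratFuncExpansionAtInfty w) =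
      LaurentSeries.derivative K (ratFuncExpansionAtInfty w - HahnSeries.C b) := by
    rw [map_sub, Literature.RingTheory.PowerSeries.derivative_C, sub_zero]
  have hdu := Literature.RingTheory.PowerSeries.derivative_ne_zero_of_cast_order_ne_zero hu0 he
  obtain ⟨hsne, hsord⟩ := order_neg_single_mul hdu 2
  have hfne : ratFuncExpansionAt b f ≠ 0 := (_root_.map_ne_zero _).mpr hf
  rw [map_mul, ratFuncExpansionAtInfty_ratFuncSubst_of_finite w hw hu f, ratFuncExpansionAtInfty_derivation D hD w, hder,
    HahnSeries.order_mul (Literature.RingTheory.PowerSeries.laurentSubst_ne_zero _ hfne) hsne,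
    Literature.RingTheory.PowerSeries.order_laurentSubst hu hu0 hfne, hsord,
    Literature.RingTheory.PowerSeries.order_derivative_of_cast_order_ne_zero hu0 he]
  ring

/-- **`∞ ↦ ∞`** (`u := E_∞(1/w)` of positive order `e`, tame): for `f ≠ 0`,
`v(E_∞((f ∘ w) · Dw)) = (v_∞(f) − 2) · e + (e + 1)`. [cite: Stichtenoth2009, Def. 3.1.5, Prop. 1.2.1 (c), Thm. 3.5.1 (b)] -/
theorem order_ratFuncExpansionAtInfty_pullback_of_pole (hu : 0 < (ratFuncExpansionAtInfty w⁻¹).orderTop)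
    (he : ((ratFuncExpansionAtInfty w⁻¹).order : K) ≠ 0) {f : RatFunc K} (hf : f ≠ 0) :
    (ratFuncExpansionAtInfty (ratFuncSubst w hw f * D w)).order =
      ((ratFuncExpansionAtInfty f).order - 2) * (ratFuncExpansionAtInfty w⁻¹).order +
        ((ratFuncExpansionAtInfty w⁻¹).order + 1) := by
  have hu0 := (expansion_ne_zero'' w hw 0 0).2.2.1
  have hw' : ratFuncExpansionAtInfty w = (ratFuncExpansionAtInfty w⁻¹)⁻¹ := by rw [map_inv₀, inv_inv]
  have hdu := Literature.RingTheory.PowerSeries.derivative_ne_zero_of_cast_order_ne_zero hu0 he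
  obtain ⟨hdne, hdord⟩ := order_derivative_inv hu0 hdu
  obtain ⟨hsne, hsord⟩ := order_neg_single_mul hdne 2
  have hfne : ratFuncExpansionAtInfty f ≠ 0 := (_root_.map_ne_zero _).mpr hf
  rw [map_mul, ratFuncExpansionAtInfty_ratFuncSubst_of_pole w hw hu f, ratFuncExpansionAtInfty_derivation D hD w, hw',
    HahnSeries.order_mul (Literature.RingTheory.PowerSeries.laurentSubst_ne_zero _ hfne) hsne,
    Literature.RingTheory.PowerSeries.order_laurentSubst hu hu0 hfne, hsord, hdord,
    Literature.RingTheory.PowerSeries.order_derivative_of_cast_order_ne_zero hu0 he]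
  ring

end Subst

end Literature.FieldTheory.FunctionField
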